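import Summits.QuantumFields.YangMills.Theorems.ConvexGribovBodyNonSimplyConnectedLatticeGapStubSectorIdentity
import Summits.QuantumFields.YangMills.Theorems.ConvexGribovBodyNonSimplyConnectedLatticeGapStubSectorMixtureAux1
import Summits.QuantumFields.YangMills.Theorems.ConvexGribovBodyNonSimplyConnectedLatticeGapStubSectorMixtureAux2
import HarnessLib

/-!
# Crux `NonSimplyConnectedLatticeGap` (stmt-QuantumFields-16405), route `ConvexGribovBody`,
# line `twist-equipartition-blindness` — stub `stub_sectorMixture` (MIX), auxiliary layer 3

The two one-torus statements behind the sector mixture step, for the torus Wilson measure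
`μ̃ = wilsonMeasure ρ β` on `GaugeConfig 4 L H`, a labelling `cls` of configurations by
`Option (planes → Z)` ('t Hooft flux sectors, `none` = the bad event) and local gauge-invariant
observables of `G` pulled back along `π : H →* G` and the periodic lift:

* `mix_blind_at` — (II) AXIS EXCHANGE: electric equipartition and electric blindness (pairs of labels
  agreeing on the magnetic planes) give blindness for ALL pairs, because every magnetic plane is
  electric after an axis permutation (interface clause X5, transported by `mix_perm_measure`,
  `mix_perm_setIntegral`, `mix_perm_pullback` of layer 2) and any two labels are joined by one
  electric and three magnetic steps (`mix_path`, chained by `mix_blind_comp` of layer 1);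
* `mix_cov_at` (registered sub-goal) — (I) the LAW OF TOTAL COVARIANCE `stub_sectorIdentity` over the
  finite measurable partition into sectors, translation invariance of the sectors (X6) to undo the
  time shift of the second observable, and the abstract bound `mix_bound_abstract`:
  `|∫ Ã B̃_w − ∫ Ã ∫ B̃_0| ≤ ε + ½ δ_A δ_B + 6 M_A M_B μ̃{cls = none}`.
-/

set_option autoImplicit false

noncomputable section

open MeasureTheory
open Literature.MathematicalPhysics.QuantumFieldTheory Literature.MathematicalPhysics.QuantumLattice
open Summit.QuantumFields.YangMills.Theorems.FiniteSusceptibilityWeakCoupling.AxisIsotropy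
  (permSpecies permSpecies_F)

namespace Summit.QuantumFields.YangMills.Theorems.NonSimplyConnectedLatticeGap

section BlindAt

variable {G H : Type} [Group G] [MeasurableSpace G] [Group H] [TopologicalSpace H]
  [IsTopologicalGroup H] [CompactSpace H] [MeasurableSpace H] [BorelSpace H]

/-- **Full sector blindness from electric blindness (axis exchange + chaining), one torus.**
On the torus of side `L`, let `cls` label configurations by `Option (planes → Z)` with measurable
fibres and the axis-exchange clause X5, let `p z = μ̃{cls = some z}` and
`a B z = ∫_{cls = some z} B(π ∘ torusLift) dμ̃`. If ELECTRICALLY related pairs (equal on the magnetic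
planes `q.1.1 ≠ 0`) satisfy equipartition `|p_z − p_w| ≤ C₁ ε p_w` and blindness
`|p_w a_B(z) − p_z a_B(w)| ≤ C₂(B) η p_z p_w` for every species `B`, then EVERY pair satisfies
blindness for `A` with constant `4 (|C₂ A| + Σ_τ |C₂ (permSpecies τ A)|)`: each magnetic plane is
electric after an axis permutation `σ` (X5; `mix_perm_measure`, `mix_perm_setIntegral` with the
permuted species `permSpecies σ⁻¹ A`), and any two labels are joined by one electric and three
magnetic steps (`mix_path`), chained by `mix_blind_comp`. -/
theorem mix_blind_at (π : H →* G) {N L : ℕ} [NeZero L] (ρ : H →* Matrix (Fin N) (Fin N) ℂ)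
    (hρ : Continuous ρ) (β : ℝ) {Z : Type}
    (cls : GaugeConfig 4 L H → Option ({p : Fin 4 × Fin 4 // p.1 < p.2} → Z))
    (hXm : ∀ o, MeasurableSet (cls ⁻¹' {o}))
    (hX5 : ∀ q : {p : Fin 4 × Fin 4 // p.1 < p.2}, q.1.1 ≠ 0 → ∃ (σ : Equiv.Perm (Fin 4))
      (Ψ : ({p : Fin 4 × Fin 4 // p.1 < p.2} → Z) → ({p : Fin 4 × Fin 4 // p.1 < p.2} → Z)),
      Function.Injective Ψ ∧ (∀ V : GaugeConfig 4 L H, cls (configPerm σ V) = (cls V).map Ψ) ∧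
      (∀ z w : {p : Fin 4 × Fin 4 // p.1 < p.2} → Z,
        (∀ q' : {p : Fin 4 × Fin 4 // p.1 < p.2}, q' ≠ q → z q' = w q') →
        ∀ q'' : {p : Fin 4 × Fin 4 // p.1 < p.2}, q''.1.1 ≠ 0 → Ψ z q'' = Ψ w q''))
    (A : YMSpecies G) (C₁ ε η : ℝ) (hη : 0 ≤ η) (C₂ : YMSpecies G → ℝ)
    (p : ({p : Fin 4 × Fin 4 // p.1 < p.2} → Z) → ℝ)
    (a : YMSpecies G → ({p : Fin 4 × Fin 4 // p.1 < p.2} → Z) → ℝ)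
    (hp : ∀ z, p z = ((wilsonMeasure (d := 4) (L := L) ρ β) (cls ⁻¹' {some z})).toReal)
    (ha : ∀ B z, a B z = ∫ V in cls ⁻¹' {some z}, B.F (fun e => π (torusLift L V e))
      ∂(wilsonMeasure (d := 4) (L := L) ρ β))
    (hequi : ∀ z w : {p : Fin 4 × Fin 4 // p.1 < p.2} → Z,
      (∀ q : {p : Fin 4 × Fin 4 // p.1 < p.2}, q.1.1 ≠ 0 → z q = w q) → |p z - p w| ≤ C₁ * ε * p w)
    (heblind : ∀ (B : YMSpecies G) (z w : {p : Fin 4 × Fin 4 // p.1 < p.2} → Z),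
      (∀ q : {p : Fin 4 × Fin 4 // p.1 < p.2}, q.1.1 ≠ 0 → z q = w q) →
        |p w * a B z - p z * a B w| ≤ C₂ B * η * p z * p w) :
    ∀ z w : {p : Fin 4 × Fin 4 // p.1 < p.2} → Z, |p w * a A z - p z * a A w| ≤
      4 * (|C₂ A| + ∑ τ : Equiv.Perm (Fin 4), |C₂ (permSpecies τ A)|) * η * (p z * p w) := by
  intro z₀ w₀
  haveI := isProbabilityMeasure_wilsonMeasure (d := 4) (L := L) ρ hρ β
  set c₂ : ℝ := |C₂ A| + ∑ τ : Equiv.Perm (Fin 4), |C₂ (permSpecies τ A)| with hc₂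
  have hc₂τ : ∀ τ : Equiv.Perm (Fin 4), C₂ (permSpecies τ A) ≤ c₂ := fun τ =>
    (le_abs_self _).trans ((Finset.single_le_sum (f := fun τ => |C₂ (permSpecies τ A)|)
      (fun τ _ => abs_nonneg _) (Finset.mem_univ τ)).trans
        (le_add_of_nonneg_left (abs_nonneg _)))
  have hc₂A : C₂ A ≤ c₂ :=
    (le_abs_self _).trans (le_add_of_nonneg_right (Finset.sum_nonneg fun τ _ => abs_nonneg _))
  have hp0 : ∀ z, 0 ≤ p z := fun z => by rw [hp]; exact ENNReal.toReal_nonneg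
  have h0 : ∀ z, p z = 0 → a A z = 0 := by
    intro z hz
    rw [hp, ENNReal.toReal_eq_zero_iff] at hz
    rcases hz with hz | hz
    · rw [ha]
      exact setIntegral_measure_zero _ hz
    · exact absurd hz (measure_ne_top _ _)
  -- transport along an axis exchange
  have hperm : ∀ (σ : Equiv.Perm (Fin 4))
      (Ψ : ({p : Fin 4 × Fin 4 // p.1 < p.2} → Z) → ({p : Fin 4 × Fin 4 // p.1 < p.2} → Z)),
      Function.Injective Ψ → (∀ V : GaugeConfig 4 L H, cls (configPerm σ V) = (cls V).map Ψ) →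
      ∀ z, p (Ψ z) = p z ∧ a (permSpecies σ.symm A) (Ψ z) = a A z := by
    intro σ Ψ hΨ hcls z
    refine ⟨?_, ?_⟩
    · rw [hp, hp, mix_perm_measure ρ hρ β σ cls Ψ hΨ hcls hXm z]
    · rw [ha, ha]
      exact mix_perm_setIntegral ρ hρ β σ cls Ψ hΨ hcls z _ _ (fun V => mix_perm_pullback π σ A L V)
  -- the base relation: electrically related, or differing at one magnetic plane only
  have base_null : ∀ v w : {p : Fin 4 × Fin 4 // p.1 < p.2} → Z,
      ((∀ q : {p : Fin 4 × Fin 4 // p.1 < p.2}, q.1.1 ≠ 0 → v q = w q) ∨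
        ∃ q : {p : Fin 4 × Fin 4 // p.1 < p.2}, q.1.1 ≠ 0 ∧
          ∀ q' : {p : Fin 4 × Fin 4 // p.1 < p.2}, q' ≠ q → v q' = w q') →
      p v = 0 → p w = 0 := by
    intro v w hvw hv
    rcases hvw with hel | ⟨q, hq, hdiff⟩
    · have h := hequi w v (fun q hq => (hel q hq).symm)
      rw [hv, mul_zero, sub_zero] at h
      exact abs_nonpos_iff.mp h
    · obtain ⟨σ, Ψ, hΨ, hcls, hrel⟩ := hX5 q hq
      have h := hequi (Ψ w) (Ψ v) (hrel w v (fun q' hq' => (hdiff q' hq').symm))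
      rw [(hperm σ Ψ hΨ hcls w).1, (hperm σ Ψ hΨ hcls v).1, hv, mul_zero, sub_zero] at h
      exact abs_nonpos_iff.mp h
  have base_blind : ∀ z w : {p : Fin 4 × Fin 4 // p.1 < p.2} → Z,
      ((∀ q : {p : Fin 4 × Fin 4 // p.1 < p.2}, q.1.1 ≠ 0 → z q = w q) ∨
        ∃ q : {p : Fin 4 × Fin 4 // p.1 < p.2}, q.1.1 ≠ 0 ∧
          ∀ q' : {p : Fin 4 × Fin 4 // p.1 < p.2}, q' ≠ q → z q' = w q') →
      |p w * a A z - p z * a A w| ≤ c₂ * η * (p z * p w) := by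
    intro z w hzw
    have hnn : 0 ≤ η * (p z * p w) := mul_nonneg hη (mul_nonneg (hp0 z) (hp0 w))
    rcases hzw with hel | ⟨q, hq, hdiff⟩
    · calc |p w * a A z - p z * a A w| ≤ C₂ A * η * p z * p w := heblind A z w hel
        _ = C₂ A * (η * (p z * p w)) := by ring
        _ ≤ c₂ * (η * (p z * p w)) := mul_le_mul_of_nonneg_right hc₂A hnn
        _ = c₂ * η * (p z * p w) := by ring
    · obtain ⟨σ, Ψ, hΨ, hcls, hrel⟩ := hX5 q hq
      have hb := heblind (permSpecies σ.symm A) (Ψ z) (Ψ w) (hrel z w hdiff)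
      rw [(hperm σ Ψ hΨ hcls z).1, (hperm σ Ψ hΨ hcls w).1, (hperm σ Ψ hΨ hcls z).2,
        (hperm σ Ψ hΨ hcls w).2] at hb
      calc |p w * a A z - p z * a A w| ≤ C₂ (permSpecies σ.symm A) * η * p z * p w := hb
        _ = C₂ (permSpecies σ.symm A) * (η * (p z * p w)) := by ring
        _ ≤ c₂ * (η * (p z * p w)) := mul_le_mul_of_nonneg_right (hc₂τ σ.symm) hnn
        _ = c₂ * η * (p z * p w) := by ring
  -- chain: one electric step and three magnetic steps
  have two := mix_blind_comp _ _ p (a A) η c₂ c₂ hp0 h0 base_null base_blind base_blind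
  have three := mix_blind_comp _ _ p (a A) η (c₂ + c₂) c₂ hp0 h0 base_null
    (fun z w (h : ∃ v, _ ∧ _) => by obtain ⟨v, h1, h2⟩ := h; exact two z v w h1 h2) base_blind
  have four := mix_blind_comp _ _ p (a A) η (c₂ + c₂ + c₂) c₂ hp0 h0 base_null
    (fun z w (h : ∃ v, _ ∧ _) => by obtain ⟨v, h1, h2⟩ := h; exact three z v w h1 h2) base_blind
  obtain ⟨v₁, v₂, v₃, h01, h12, h23, h34⟩ := mix_path z₀ w₀
  have key := four z₀ v₃ w₀ ⟨v₂, ⟨v₁, Or.inl h01, Or.inr ⟨_, by decide, h12⟩⟩,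
    Or.inr ⟨_, by decide, h23⟩⟩ (Or.inr ⟨_, by decide, h34⟩)
  calc |p w₀ * a A z₀ - p z₀ * a A w₀| ≤ (c₂ + c₂ + c₂ + c₂) * η * (p z₀ * p w₀) := key
    _ = 4 * c₂ * η * (p z₀ * p w₀) := by ring

end BlindAt


section CovAt

variable {G H : Type} [Group G] [MeasurableSpace G] [TopologicalSpace G] [BorelSpace G] [Group H]
  [TopologicalSpace H] [IsTopologicalGroup H] [CompactSpace H] [MeasurableSpace H] [BorelSpace H]

/-- **The mixture bound on one torus.** For the torus Wilson measure `μ̃ = wilsonMeasure ρ β` on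
`GaugeConfig 4 L H`, a finite labelling `cls` with measurable, translation-invariant fibres (X_m, X6),
bounded species `A, B` of `G` pulled back along `π` and the periodic lift (`Ã`, and `B̃_w` translated
by `w ∈ ℤ⁴`), per-sector clustering `ε` on labelled sectors and full blindness `δ_A, δ_B` of the
UNtranslated sector integrals:
`|∫ Ã B̃_w − ∫ Ã ∫ B̃_0| ≤ ε + ½ δ_A δ_B + 6 M_A M_B μ̃{cls = none}`.
Proof: translation invariance (`mix_shift_setIntegral`) replaces every (sector) integral of `B̃_w` by
that of `B̃_0`; the law of total covariance `stub_sectorIdentity` over the partition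
`{cls = o}_{o : Option K}`; the abstract bound `mix_bound_abstract` with the crude sector bounds
`|∫_E F| ≤ ‖F‖_∞ μ̃(E)`. -/
theorem mix_cov_at : ∀ {G H : Type} [Group G] [MeasurableSpace G] [TopologicalSpace G] [BorelSpace G] [Group H]
    [TopologicalSpace H] [IsTopologicalGroup H] [CompactSpace H] [MeasurableSpace H] [BorelSpace H]
    (π : H →* G), Continuous π → ∀ {N L : ℕ} [NeZero L] (ρ : H →* Matrix (Fin N) (Fin N) ℂ),
    Continuous ρ → ∀ (β : ℝ) (μ : MeasureTheory.Measure
    (Literature.MathematicalPhysics.QuantumFieldTheory.GaugeConfig 4 L H)), μ =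
    Literature.MathematicalPhysics.QuantumFieldTheory.wilsonMeasure (d := 4) (L := L) ρ β → ∀ {K :
    Type} [Fintype K] (cls : Literature.MathematicalPhysics.QuantumFieldTheory.GaugeConfig 4 L H →
    Option K), (∀ o : Option K, MeasurableSet (cls ⁻¹' {o})) → (∀ (v :
    Literature.MathematicalPhysics.QuantumFieldTheory.Site 4 L) (V :
    Literature.MathematicalPhysics.QuantumFieldTheory.GaugeConfig 4 L H), cls (fun e => V (e.1 + v,
    e.2)) = cls V) → ∀ (A B : Literature.MathematicalPhysics.QuantumFieldTheory.YMSpecies G) (MA MB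
    : ℝ), (∀ U : Literature.MathematicalPhysics.QuantumLattice.LGConfig 4 G, |A.F U| ≤ MA) → (∀ U :
    Literature.MathematicalPhysics.QuantumLattice.LGConfig 4 G, |B.F U| ≤ MB) → ∀ (w :
    Literature.Probability.LatticeModels.Site 4) (ε δA δB : ℝ), 0 ≤ ε → 0 ≤ δA → 0 ≤ δB → (∀ z : K,
    |(∫ V in cls ⁻¹' {some z}, A.F (fun e => π
    (Literature.MathematicalPhysics.QuantumLattice.torusLift L V e)) * B.F (fun e => π
    (Literature.MathematicalPhysics.QuantumLattice.configShift w
    (Literature.MathematicalPhysics.QuantumLattice.torusLift L V) e)) ∂μ) - ((μ (cls ⁻¹' {some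
    z})).toReal)⁻¹ * (∫ V in cls ⁻¹' {some z}, A.F (fun e => π
    (Literature.MathematicalPhysics.QuantumLattice.torusLift L V e)) ∂μ) * (∫ V in cls ⁻¹' {some z},
    B.F (fun e => π (Literature.MathematicalPhysics.QuantumLattice.configShift w
    (Literature.MathematicalPhysics.QuantumLattice.torusLift L V) e)) ∂μ)| ≤ ε * (μ (cls ⁻¹' {some
    z})).toReal) → (∀ z z' : K, |(μ (cls ⁻¹' {some z'})).toReal * (∫ V in cls ⁻¹' {some z}, A.F (fun
    e => π (Literature.MathematicalPhysics.QuantumLattice.torusLift L V e)) ∂μ) - (μ (cls ⁻¹' {some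
    z})).toReal * (∫ V in cls ⁻¹' {some z'}, A.F (fun e => π
    (Literature.MathematicalPhysics.QuantumLattice.torusLift L V e)) ∂μ)| ≤ δA * ((μ (cls ⁻¹' {some
    z})).toReal * (μ (cls ⁻¹' {some z'})).toReal)) → (∀ z z' : K, |(μ (cls ⁻¹' {some z'})).toReal *
    (∫ V in cls ⁻¹' {some z}, B.F (fun e => π
    (Literature.MathematicalPhysics.QuantumLattice.torusLift L V e)) ∂μ) - (μ (cls ⁻¹' {some
    z})).toReal * (∫ V in cls ⁻¹' {some z'}, B.F (fun e => π
    (Literature.MathematicalPhysics.QuantumLattice.torusLift L V e)) ∂μ)| ≤ δB * ((μ (cls ⁻¹' {some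
    z})).toReal * (μ (cls ⁻¹' {some z'})).toReal)) → |(∫ V, A.F (fun e => π
    (Literature.MathematicalPhysics.QuantumLattice.torusLift L V e)) * B.F (fun e => π
    (Literature.MathematicalPhysics.QuantumLattice.configShift w
    (Literature.MathematicalPhysics.QuantumLattice.torusLift L V) e)) ∂μ) - (∫ V, A.F (fun e => π
    (Literature.MathematicalPhysics.QuantumLattice.torusLift L V e)) ∂μ) * (∫ V, B.F (fun e => π
    (Literature.MathematicalPhysics.QuantumLattice.torusLift L V e)) ∂μ)| ≤ ε + (1 / 2) * (δA * δB)
    + 6 * (MA * MB * (μ (cls ⁻¹' {none})).toReal) := by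
  intro G H _ _ _ _ _ _ _ _ _ _ π hπ N L _ ρ hρ β μ hμ K _ cls hXm hX6 A B MA MB hMA hMB w ε δA δB hε hδA
    hδB hpsc hA hB
  subst hμ
  haveI := isProbabilityMeasure_wilsonMeasure (d := 4) (L := L) ρ hρ β
  have hMA0 : 0 ≤ MA := (abs_nonneg _).trans (hMA fun _ => 1)
  have hMB0 : 0 ≤ MB := (abs_nonneg _).trans (hMB fun _ => 1)
  -- the translated observable is the untranslated one after a torus translation
  have hBw : ∀ V : GaugeConfig 4 L H, B.F (fun e => π (configShift w (torusLift L V) e)) =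
      B.F (fun e => π (torusLift L
        (torusConfigShift (Literature.Probability.LatticeModels.Torus.proj L w) V) e)) := by
    intro V
    rw [mix_configShift_torusLift]
  have hshift : ∀ s : Set (GaugeConfig 4 L H),
      (torusConfigShift (Literature.Probability.LatticeModels.Torus.proj L w)) ⁻¹' s = s →
      ∫ V in s, B.F (fun e => π (configShift w (torusLift L V) e))
          ∂(wilsonMeasure (d := 4) (L := L) ρ β) =
        ∫ V in s, B.F (fun e => π (torusLift L V e)) ∂(wilsonMeasure (d := 4) (L := L) ρ β) := by
    intro s hs
    simp only [hBw]
    exact mix_shift_setIntegral ρ β _ s hs (fun V => B.F (fun e => π (torusLift L V e)))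
  have hshiftE : ∀ o : Option K,
      ∫ V in cls ⁻¹' {o}, B.F (fun e => π (configShift w (torusLift L V) e))
          ∂(wilsonMeasure (d := 4) (L := L) ρ β) =
        ∫ V in cls ⁻¹' {o}, B.F (fun e => π (torusLift L V e))
          ∂(wilsonMeasure (d := 4) (L := L) ρ β) :=
    fun o => hshift _ (mix_shift_preimage cls hX6 _ {o})
  have hshiftU : ∫ V, B.F (fun e => π (configShift w (torusLift L V) e))
        ∂(wilsonMeasure (d := 4) (L := L) ρ β) =
      ∫ V, B.F (fun e => π (torusLift L V e)) ∂(wilsonMeasure (d := 4) (L := L) ρ β) := by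
    have h := hshift Set.univ Set.preimage_univ
    rwa [Measure.restrict_univ] at h
  -- measurability, integrability, crude bounds
  have hAm : Measurable fun V : GaugeConfig 4 L H => A.F (fun e => π (torusLift L V e)) :=
    mix_measurable_comp π hπ (measurable_torusLift L) A.F A.measurable
  have hB0m : Measurable fun V : GaugeConfig 4 L H => B.F (fun e => π (torusLift L V e)) :=
    mix_measurable_comp π hπ (measurable_torusLift L) B.F B.measurable
  have hBm : Measurable fun V : GaugeConfig 4 L H =>
      B.F (fun e => π (configShift w (torusLift L V) e)) :=
    mix_measurable_comp π hπ (T := fun V => configShift w (torusLift L V))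
      ((configShift w).measurable.comp (measurable_torusLift L)) B.F B.measurable
  have hABb : ∀ V : GaugeConfig 4 L H, |A.F (fun e => π (torusLift L V e)) *
      B.F (fun e => π (configShift w (torusLift L V) e))| ≤ MA * MB := fun V => by
    rw [abs_mul]
    exact mul_le_mul (hMA _) (hMB _) (abs_nonneg _) hMA0
  have hAi := mix_integrable_of_bound ρ hρ β _ hAm MA (fun V => hMA _)
  have hBi := mix_integrable_of_bound ρ hρ β _ hBm MB (fun V => hMB _)
  have hABi := mix_integrable_of_bound ρ hρ β _ (hAm.mul hBm) (MA * MB) hABb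
  -- the partition into sectors
  have hdisj : Pairwise (Function.onFun Disjoint fun o : Option K => cls ⁻¹' {o}) :=
    fun o o' h => (Set.disjoint_singleton.2 h).preimage cls
  have hcover : (⋃ o : Option K, cls ⁻¹' {o}) = Set.univ :=
    Set.iUnion_eq_univ_iff.2 fun V => ⟨cls V, rfl⟩
  have hp0 : ∀ o : Option K, 0 ≤ ((wilsonMeasure (d := 4) (L := L) ρ β) (cls ⁻¹' {o})).toReal :=
    fun o => ENNReal.toReal_nonneg
  have hp1 : ∑ o : Option K, ((wilsonMeasure (d := 4) (L := L) ρ β) (cls ⁻¹' {o})).toReal = 1 := by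
    have h := measureReal_iUnion_fintype (μ := wilsonMeasure (d := 4) (L := L) ρ β) hdisj hXm
    rw [hcover, probReal_univ] at h
    simpa only [measureReal_def] using h.symm
  -- law of total covariance
  have hid := stub_sectorIdentity (GaugeConfig 4 L H) (wilsonMeasure (d := 4) (L := L) ρ β)
    (Option K) (fun o => cls ⁻¹' {o}) hXm hdisj hcover
    (fun V => A.F (fun e => π (torusLift L V e)))
    (fun V => B.F (fun e => π (configShift w (torusLift L V) e))) hAi hBi hABi
  rw [hshiftU] at hid
  rw [hid]
  refine mix_bound_abstract (fun o => ((wilsonMeasure (d := 4) (L := L) ρ β) (cls ⁻¹' {o})).toReal)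
    (fun o => ∫ V in cls ⁻¹' {o}, A.F (fun e => π (torusLift L V e))
      ∂(wilsonMeasure (d := 4) (L := L) ρ β))
    (fun o => ∫ V in cls ⁻¹' {o}, B.F (fun e => π (configShift w (torusLift L V) e))
      ∂(wilsonMeasure (d := 4) (L := L) ρ β))
    (fun o => ∫ V in cls ⁻¹' {o}, A.F (fun e => π (torusLift L V e)) *
      B.F (fun e => π (configShift w (torusLift L V) e)) ∂(wilsonMeasure (d := 4) (L := L) ρ β))
    MA MB ε δA δB hp0 hp1 hMA0 hMB0 hε hδA hδB
    (fun o => mix_abs_setIntegral_le ρ hρ β _ MA (fun V => hMA _) _)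
    (fun o => mix_abs_setIntegral_le ρ hρ β _ MB (fun V => hMB _) _)
    (fun o => mix_abs_setIntegral_le ρ hρ β _ (MA * MB) hABb _) hpsc hA ?_
  intro z z'
  rw [hshiftE, hshiftE]
  exact hB z z'

end CovAt

end Summit.QuantumFields.YangMills.Theorems.NonSimplyConnectedLatticeGap

end
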